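import Summits.QuantumFields.QCD.Theorems.MobilityGap.Negative.LowerPin

/-!
# Crux `MobilityGap` (stmt-QuantumFields-9150) — necessity: every witness is at most `O(a_k)` above the free critical point

Support file (`--supports stmt-QuantumFields-9150`) of line `Sketch`, lead c3 (cycle 4).  Sorry-free.

The standing disproof (`Negative/LowerPin.lean`, p98811) shows with the hopping window
`|m_f(k) + 4| ≥ 41/10` that clause (iii) LOWER forces `m_crit(k) < 1/10` eventually.  Here the same
argument is run with the tree's `ℓ²` Neumann bound at EVERY positive bare mass
(`norm_inv_wilsonDirac_apply_le`: `|D_W(m)⁻¹(p,q)| ≤ m⁻¹ (4/(m+4))^{d_i(p,q)}` for `m > 0`, uniformly in the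
torus and the gauge field — the `κ < 1/8` disc), whose lattice rate `log(1 + m/4)` is positive but
degenerates linearly as `m ↓ 0`:

* `fm_le_of_pos` — for every coupling, every bare tuple `mq`, every flavour `f` with `0 < mq f`, every
  torus, every `s ∈ (0,1)` and every `v ∈ box S`:
  `fm ≤ (144 / mq f)^s · exp(−s·log(1 + mq f/4)·‖v‖)` (configuration-wise bound integrated against the
  positive weight; configurations where another flavour is singular carry weight `0`).
* `not_lower_matrix_of_frequently_fast` — the matrix of clause (iii) with data `(s, c₀, C₁, p)` is
  incompatible with `0 < m_f(k)` and `C₁ a_k < s·log(1 + m_f(k)/4)` for infinitely many `k`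
  (`no_rate_sandwich` at such a `k`).
* `eventually_bare_le_of_lower_matrix` — hence eventually `m_f(k) ≤ max 0 (4 (exp(C₁ a_k / s) − 1))`;
* `exists_bare_le_mul_a_of_lower`, `exists_mcrit_le_mul_a_of_lower` — so `m_f(k) ≤ K a_k` and
  `m_crit(k) ≤ K a_k` eventually, for an explicit `K = 8|C₁|/s`;
* `mobilityGap_witness_order` — crux-level corollary: every witness of `MobilityGap` realises, for every
  positive mass tuple, bare masses `≤ K a_k`, and has `m_crit(k) ≤ K a_k` eventually.

Reading: any proof of the crux must place the whole bare trajectory in the closed supercritical region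
`κ ≥ 1/8 − O(a_k)` of Wilson fermions (`m ≤ O(a_k)`), where no background-uniform resolvent bound exists;
the `O(a_k)` is sharp for this method (the rate of the `ℓ²` bound is `≍ m`, and (iii) tolerates lattice
rates `≤ C₁ a_k / s`).  Physically `m_crit(k) → 0⁻` like `−g₀(a_k)²`, consistent.

References: I. Montvay, G. Münster, *Quantum Fields on a Lattice* (CUP 1994), §4.1, §5.1.2
[MontvayMunster1994]; P. Hernández, K. Jansen, M. Lüscher, Nucl. Phys. B 552 (1999) 363, (2.14)
[HernandezJansenLuscher1999].
-/

noncomputable section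

namespace Summit.QuantumFields.QCD.Theorems.MobilityGapCriticalMassOrder

open scoped BigOperators Topology
open MeasureTheory Filter Set
open Literature.MathematicalPhysics.QuantumFieldTheory Literature.MathematicalPhysics.QuantumLattice
  Literature.Probability.LatticeModels
open Summit.QuantumFields.QCD.Theorems.MobilityGapNegative

variable {Nf : ℕ}

/-! ### §1 The phase-quenched fractional moment at a positive bare mass of the measured flavour -/

/-- **Light-positive-mass bound of the phase-quenched fractional moment.**  For every coupling `β`,
every bare tuple `mq` and every flavour `f` with `0 < mq f`, on every torus of side `2S+1`, for every
`s ∈ (0,1)` and every `v ∈ box 4 S`: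
`fm ≤ (144 / mq f)^s · exp (−(s · log (1 + mq f / 4)) · ‖v‖)`.
Configuration-wise `ℓ²` Neumann bound `|D_W(m)⁻¹(p,q)| ≤ m⁻¹ (4/(m+4))^{d_i(p,q)}` of the measured
flavour (tree `norm_inv_wilsonDirac_apply_le`), summed over the `144` colour–spin entries, raised to the
power `s` and integrated against the positive weight `|det (diracMatrix U mq)|`; configurations at which
some flavour's Wilson matrix is singular carry weight `0`.  The rate `log(1 + m/4) > 0` is a LATTICE rate
that degenerates linearly in `m`. -/
theorem fm_le_of_pos (Nf : ℕ) (β : ℝ) (mq : Fin Nf → ℝ) (f : Fin Nf) (hf : 0 < mq f) (S : ℕ)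
    {s : ℝ} (hs0 : 0 < s) (hs1 : s < 1) (v : Site 4) (hv : v ∈ box 4 S) :
    fm Nf β mq S f v s ≤
      (144 / mq f) ^ s * Real.exp (-(s * Real.log (1 + mq f / 4) * ‖v‖)) := by
  set M : ℝ := mq f with hM
  set θ : ℝ := 4 / (M + 4) with hθ
  have hM4 : 0 < M + 4 := by linarith
  have hθpos : 0 < θ := by positivity
  have hθlt : θ < 1 := by rw [hθ, div_lt_one hM4]; linarith
  have hlogθ : Real.log θ = -Real.log (1 + M / 4) := by
    have e : 1 + M / 4 = θ⁻¹ := by rw [hθ, inv_div]; field_simp; ring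
    rw [e, Real.log_inv, neg_neg]
  -- the sup-distance `n = ‖v‖∞ = |v i₀|`, `i₀` a maximal coordinate
  obtain ⟨i₀, -, hmax⟩ :=
    Finset.exists_max_image Finset.univ (fun i : Fin 4 => ‖v i‖) Finset.univ_nonempty
  have hvi : |v i₀| ≤ (S : ℤ) := by
    have := Fintype.mem_piFinset.1 hv i₀
    rw [Finset.mem_Icc] at this
    exact abs_le.2 ⟨by linarith [this.1], this.2⟩
  set n : ℕ := (v i₀).natAbs with hn
  have hnorm : ‖v‖ ≤ (n : ℝ) := by
    have h1 : ‖v‖ ≤ ‖v i₀‖ :=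
      (pi_norm_le_iff_of_nonneg (norm_nonneg _)).2 fun i => hmax i (Finset.mem_univ i)
    rw [Int.norm_eq_abs] at h1
    rw [hn, Nat.cast_natAbs, Int.cast_abs]
    exact h1
  set K : ℝ := M⁻¹ * θ ^ n with hK
  have hK0 : 0 ≤ K := by positivity
  have hcd : ((Torus.proj (2 * S + 1) (0 : Site 4)) i₀ -
      (Torus.proj (2 * S + 1) v) i₀).valMinAbs.natAbs = n := by
    simp only [Torus.proj, Pi.zero_apply, Int.cast_zero, zero_sub]
    exact natAbs_valMinAbs_neg_intCast (v i₀) (by exact_mod_cast hvi)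
  -- entry bound at configurations where every flavour is invertible
  have hentry : ∀ U : GaugeConfig 4 (2 * S + 1) (Matrix.specialUnitaryGroup (Fin 3) ℂ),
      (∀ g, (wilsonDirac (fundamentalRep (Fin 3)) U (mq g) 1).det ≠ 0) →
      ∀ (a' : Fin 3) (i : Fin 4) (b : Fin 3) (j : Fin 4),
        ‖(diracMatrix U mq)⁻¹ (quarkEquiv (f, (Torus.proj (2 * S + 1) 0, a', i)))
          (quarkEquiv (f, (Torus.proj (2 * S + 1) v, b, j)))‖ ≤ K := by
    intro U hA a' i b j
    rw [inv_diracMatrix_apply_same_flavour U mq hA]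
    have h := (norm_inv_wilsonDirac_apply_le (fundamentalRep (Fin 3))
      fundamentalRep_mem_unitaryGroup U hf (Torus.proj (2 * S + 1) 0, a', i)
      (Torus.proj (2 * S + 1) v, b, j) i₀).2
    rw [hcd, heavy_prefactor_eq hf] at h
    exact h
  have hsum : ∀ U : GaugeConfig 4 (2 * S + 1) (Matrix.specialUnitaryGroup (Fin 3) ℂ),
      (∀ g, (wilsonDirac (fundamentalRep (Fin 3)) U (mq g) 1).det ≠ 0) →
      (∑ a' : Fin 3, ∑ i : Fin 4, ∑ b : Fin 3, ∑ j : Fin 4,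
        ‖(diracMatrix U mq)⁻¹ (quarkEquiv (f, (Torus.proj (2 * S + 1) 0, a', i)))
          (quarkEquiv (f, (Torus.proj (2 * S + 1) v, b, j)))‖) ≤ 144 * K := by
    intro U hA
    calc _ ≤ ∑ _a' : Fin 3, ∑ _i : Fin 4, ∑ _b : Fin 3, ∑ _j : Fin 4, K :=
          Finset.sum_le_sum fun a' _ => Finset.sum_le_sum fun i _ => Finset.sum_le_sum fun b _ =>
            Finset.sum_le_sum fun j _ => hentry U hA a' i b j
      _ = 144 * K := by simp; ring
  -- the uniform bound `B₀` on the fractional power of the sum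
  set B₀ : ℝ := (144 / M) ^ s * Real.exp (-(s * Real.log (1 + M / 4) * ‖v‖)) with hB₀
  have hB₀0 : 0 ≤ B₀ := by
    rw [hB₀]
    exact mul_nonneg (Real.rpow_nonneg (by positivity) _) (Real.exp_pos _).le
  have hB : (144 * K) ^ s ≤ B₀ := by
    have h1 : 144 * K = (144 / M) * θ ^ n := by rw [hK, div_eq_mul_inv]; ring
    rw [h1, Real.mul_rpow (by positivity) (by positivity), hB₀]
    refine mul_le_mul_of_nonneg_left ?_ (Real.rpow_nonneg (by positivity) _)
    have h2 : (θ ^ n) ^ s = Real.exp (s * ((n : ℝ) * Real.log θ)) := by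
      rw [Real.rpow_def_of_pos (pow_pos hθpos n), Real.log_pow]; congr 1; ring
    rw [h2, hlogθ]
    apply Real.exp_le_exp.2
    have h3 : s * Real.log (1 + M / 4) * ‖v‖ ≤ s * Real.log (1 + M / 4) * n :=
      mul_le_mul_of_nonneg_left hnorm
        (mul_nonneg hs0.le (Real.log_nonneg (by linarith [div_pos hf four_pos])))
    nlinarith
  -- pointwise bound of the integrand (singular configurations carry zero weight)
  have hpt : ∀ U : GaugeConfig 4 (2 * S + 1) (Matrix.specialUnitaryGroup (Fin 3) ℂ),
      ‖(diracMatrix U mq).det‖ *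
        (∑ a' : Fin 3, ∑ i : Fin 4, ∑ b : Fin 3, ∑ j : Fin 4,
          ‖(diracMatrix U mq)⁻¹ (quarkEquiv (f, (Torus.proj (2 * S + 1) 0, a', i)))
            (quarkEquiv (f, (Torus.proj (2 * S + 1) v, b, j)))‖) ^ s ≤
        ‖(diracMatrix U mq).det‖ * B₀ := by
    intro U
    by_cases hA : ∀ g, (wilsonDirac (fundamentalRep (Fin 3)) U (mq g) 1).det ≠ 0
    · exact mul_le_mul_of_nonneg_left
        ((Real.rpow_le_rpow (by positivity) (hsum U hA) hs0.le).trans hB) (norm_nonneg _)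
    · have h0 : ‖(diracMatrix U mq).det‖ = 0 := by
        push Not at hA
        obtain ⟨g, hg⟩ := hA
        rw [norm_det_diracMatrix]
        exact Finset.prod_eq_zero (Finset.mem_univ g) (by rw [norm_eq_zero]; exact hg)
      rw [h0, zero_mul, zero_mul]
  have hnum : (∫ U : GaugeConfig 4 (2 * S + 1) (Matrix.specialUnitaryGroup (Fin 3) ℂ),
      ‖(diracMatrix U mq).det‖ *
      (∑ a' : Fin 3, ∑ i : Fin 4, ∑ b : Fin 3, ∑ j : Fin 4,
        ‖(diracMatrix U mq)⁻¹ (quarkEquiv (f, (Torus.proj (2 * S + 1) 0, a', i)))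
          (quarkEquiv (f, (Torus.proj (2 * S + 1) v, b, j)))‖) ^ s
      ∂(wilsonMeasure (fundamentalRep (Fin 3)) β)) ≤
      (∫ U : GaugeConfig 4 (2 * S + 1) (Matrix.specialUnitaryGroup (Fin 3) ℂ),
        ‖(diracMatrix U mq).det‖ ∂(wilsonMeasure (fundamentalRep (Fin 3)) β)) * B₀ := by
    rw [← integral_mul_const]
    refine integral_mono_of_nonneg (Eventually.of_forall fun U => ?_)
      ((integrable_norm_det_diracMatrix mq _).mul_const B₀) (Eventually.of_forall fun U => hpt U)
    exact mul_nonneg (norm_nonneg _) (Real.rpow_nonneg (by positivity) _)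
  have hZ0 : 0 ≤ ∫ U : GaugeConfig 4 (2 * S + 1) (Matrix.specialUnitaryGroup (Fin 3) ℂ),
      ‖(diracMatrix U mq).det‖ ∂(wilsonMeasure (fundamentalRep (Fin 3)) β) :=
    integral_nonneg fun U => norm_nonneg _
  unfold fm
  rcases hZ0.eq_or_lt with hZ | hZ
  · rw [← hZ, div_zero]
    exact hB₀0
  · rw [div_le_iff₀ hZ]
    exact hnum.trans_eq (mul_comm _ _)

/-! ### §2 Clause (iii) pins every bare mass to `≤ O(a_k)` -/

/-- **The matrix of clause (iii) is incompatible with frequent FAST positive masses.**  If the bound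
of clause (iii) holds eventually with data `(s, c₀, C₁, p)`, then it is impossible that for
infinitely many `k` the realised bare mass of some flavour `f` is positive with
`C₁ a_k < s · log (1 + m_f(k)/4)`: at such a `k`, `fm_le_of_pos` is a two-sided rate sandwich
excluded by `no_rate_sandwich`. -/
theorem not_lower_matrix_of_frequently_fast (reg : QCDRegularisation Nf) (m : Fin Nf → ℝ)
    (f : Fin Nf) {s c₀ C₁ p : ℝ} (hs0 : 0 < s) (hs1 : s < 1) (hc₀ : 0 < c₀)
    (hL : ∀ᶠ k in atTop, ∀ S : ℕ, reg.L k ≤ S → ∀ (g : Fin Nf) (n : ℕ), n ≤ S →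
      c₀ * Real.exp (-(C₁ * (reg.a k * n) + p * Real.log (n + 1))) ≤
        fm Nf (reg.β k) (bare reg m k) S g (Pi.single 0 (n : ℤ)) s)
    (hfast : ∃ᶠ k in atTop, 0 < bare reg m k f ∧
      C₁ * reg.a k < s * Real.log (1 + bare reg m k f / 4)) : False := by
  obtain ⟨k, hLk, hpos, hlt⟩ := (hL.and_frequently hfast).exists
  refine no_rate_sandwich (A := C₁ * reg.a k) (B := s * Real.log (1 + bare reg m k f / 4))
    (C := (144 / bare reg m k f) ^ s) (p := p) hc₀ hlt (reg.L k) fun n hn => ?_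
  have h1 := hLk n hn f n le_rfl
  have h2 := fm_le_of_pos Nf (reg.β k) (bare reg m k) f hpos n hs0 hs1 _ (single_mem_box n)
  rw [norm_single_natCast] at h2
  have e : C₁ * reg.a k * (n : ℝ) = C₁ * (reg.a k * n) := mul_assoc _ _ _
  rw [e]
  exact h1.trans h2

/-- **Eventual bound on every bare mass from the matrix of clause (iii).**  With data
`(s, c₀, C₁, p)` of clause (iii), every realised bare mass satisfies eventually
`m_f(k) ≤ max 0 (4 (exp (C₁ a_k / s) − 1))` (either it is non-positive, or its `ℓ²` lattice rate
`s·log(1 + m_f(k)/4)` is at most the tolerated rate `C₁ a_k`). -/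
theorem eventually_bare_le_of_lower_matrix (reg : QCDRegularisation Nf) (m : Fin Nf → ℝ)
    (f : Fin Nf) {s c₀ C₁ p : ℝ} (hs0 : 0 < s) (hs1 : s < 1) (hc₀ : 0 < c₀)
    (hL : ∀ᶠ k in atTop, ∀ S : ℕ, reg.L k ≤ S → ∀ (g : Fin Nf) (n : ℕ), n ≤ S →
      c₀ * Real.exp (-(C₁ * (reg.a k * n) + p * Real.log (n + 1))) ≤
        fm Nf (reg.β k) (bare reg m k) S g (Pi.single 0 (n : ℤ)) s) :
    ∀ᶠ k in atTop, bare reg m k f ≤ max 0 (4 * (Real.exp (C₁ * reg.a k / s) - 1)) := by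
  by_contra hne
  rw [not_eventually] at hne
  refine not_lower_matrix_of_frequently_fast reg m f hs0 hs1 hc₀ hL (hne.mono fun k hk => ?_)
  rw [not_le, max_lt_iff] at hk
  obtain ⟨hpos, hlt⟩ := hk
  refine ⟨hpos, ?_⟩
  -- `4 (exp (C₁ a_k / s) − 1) < bare` gives `exp (C₁ a_k / s) < 1 + bare/4`, take logs
  have h1 : Real.exp (C₁ * reg.a k / s) < 1 + bare reg m k f / 4 := by linarith
  have h2 : C₁ * reg.a k / s < Real.log (1 + bare reg m k f / 4) := by
    have := Real.log_lt_log (Real.exp_pos _) h1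
    rwa [Real.log_exp] at this
  have h3 := mul_lt_mul_of_pos_left h2 hs0
  rwa [mul_div_cancel₀ _ hs0.ne'] at h3

/-- Elementary: `4 (exp x − 1) ≤ 8 |x|` for `|x| ≤ 1`. [folklore] -/
theorem four_mul_exp_sub_one_le {x : ℝ} (hx : |x| ≤ 1) : 4 * (Real.exp x - 1) ≤ 8 * |x| := by
  have h := Real.abs_exp_sub_one_le hx
  have h' : Real.exp x - 1 ≤ 2 * |x| := (le_abs_self _).trans h
  linarith

/-- **Clause (iii) ⇒ every bare mass is `≤ K a_k` eventually**, with the explicit constant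
`K = 8|C₁|/s` read off the data `(s, c₀, C₁, p)` of the clause. -/
theorem exists_bare_le_mul_a_of_lower (reg : QCDRegularisation Nf) (m : Fin Nf → ℝ)
    (h : Lower reg m) : ∃ K : ℝ, 0 ≤ K ∧ ∀ f : Fin Nf, ∀ᶠ k in atTop, bare reg m k f ≤ K * reg.a k := by
  obtain ⟨s, c₀, C₁, p, hs0, hs1, hc₀, hL⟩ := h
  refine ⟨8 * |C₁| / s, by positivity, fun f => ?_⟩
  have hsmall : ∀ᶠ k in atTop, |C₁ * reg.a k / s| ≤ 1 := by
    have ht : Tendsto (fun k => C₁ * reg.a k / s) atTop (𝓝 (C₁ * 0 / s)) :=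
      (reg.tendsto_a.const_mul C₁).div_const s
    rw [mul_zero, zero_div] at ht
    have := ht.abs
    rw [abs_zero] at this
    exact this.eventually (eventually_le_nhds one_pos)
  filter_upwards [eventually_bare_le_of_lower_matrix reg m f hs0 hs1 hc₀ hL, hsmall] with k hk hsk
  refine hk.trans (max_le (by have := reg.a_pos k; positivity) ?_)
  refine (four_mul_exp_sub_one_le hsk).trans_eq ?_
  rw [abs_div, abs_mul, abs_of_pos (reg.a_pos k), abs_of_pos hs0]
  ring

/-- **Clause (iii) ⇒ the critical mass of the regularisation is `≤ K a_k` eventually** (for `N_f ≥ 1`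
and a positive mass tuple: the increments `a_k m_f / Z_m(k)` are positive). -/
theorem exists_mcrit_le_mul_a_of_lower (reg : QCDRegularisation Nf) (m : Fin Nf → ℝ)
    (hm : ∀ f, 0 < m f) (f : Fin Nf) (h : Lower reg m) :
    ∃ K : ℝ, 0 ≤ K ∧ ∀ᶠ k in atTop, reg.mcrit k ≤ K * reg.a k := by
  obtain ⟨K, hK, hb⟩ := exists_bare_le_mul_a_of_lower reg m h
  refine ⟨K, hK, ?_⟩
  filter_upwards [hb f] with k hk
  have hpos : 0 < reg.a k * m f / reg.Zm k := div_pos (mul_pos (reg.a_pos k) (hm f)) (reg.Zm_pos k)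
  have : reg.mcrit k + reg.a k * m f / reg.Zm k ≤ K * reg.a k := hk
  linarith

/-- **Crux-level corollary (necessity).**  Every witness of `MobilityGap` realises, for every positive
mass tuple, bare trajectories eventually below `K a_k` for some `K ≥ 0` (depending on the tuple), and its
flavour-blind critical mass satisfies `m_crit(k) ≤ K a_k` eventually: the whole content of the crux lives
in the closed supercritical region `κ ≥ 1/8 − O(a_k)` of Wilson fermions. -/
theorem mobilityGap_witness_order :
    Summit.QuantumFields.QCD.Theses.WilsonMobilityGap.MobilityGap →
    ∀ Nf : ℕ, Nf = 2 ∨ Nf = 3 → ∃ reg : QCDRegularisation Nf, Clauses Nf reg ∧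
      (∀ m : Fin Nf → ℝ, (∀ f, 0 < m f) →
        ∃ K : ℝ, 0 ≤ K ∧ ∀ f : Fin Nf, ∀ᶠ k in atTop,
          reg.mcrit k + reg.a k * m f / reg.Zm k ≤ K * reg.a k) ∧
      ∃ K : ℝ, 0 ≤ K ∧ ∀ᶠ k in atTop, reg.mcrit k ≤ K * reg.a k := by
  intro h Nf hNf
  obtain ⟨reg, hreg⟩ := mobilityGap_iff.1 h Nf hNf
  have hNf0 : 0 < Nf := by rcases hNf with rfl | rfl <;> norm_num
  refine ⟨reg, hreg, fun m hm => exists_bare_le_mul_a_of_lower reg m (hreg.2.2 m hm).2.2.1, ?_⟩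
  exact exists_mcrit_le_mul_a_of_lower reg (fun _ => 1) (fun _ => one_pos) ⟨0, hNf0⟩
    (hreg.2.2 _ fun _ => one_pos).2.2.1

end Summit.QuantumFields.QCD.Theorems.MobilityGapCriticalMassOrder

end
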